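import Literature.IUT.HodgeTheaters.LocalFrobenioidsArch
import Literature.AnabelianGeometry.AbsoluteAnabelian.ArchimedeanHolMonoidPairsLogFrobenius
import HarnessLib

/-!
# [IUTchI] Ex 3.4 (i) / Def 3.6 (b) / Def 5.2 (i) (b), (viii): the archimedean datum `ℱ_v = (𝒞_v, 𝒟_v, κ_v)` READ
# THROUGH the [AbsTopIII] §4 interface — its Aut-holomorphic `TF`- and `TM`-pairs, `κ_v` as an isomorphism onto
# `M_v(𝒟_v)`, isomorphisms of such data (abc-iut L5 HUB row «C53ii/A2 EX34-TRIPLE-TO-L4-PAIRS» of Cor 5.3 (ii))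

S. Mochizuki, *Inter-universal Teichmüller theory I*, kurims manuscript (May 2020): Ex 3.4 (i) p. 80 «there is
a natural isomorphism `𝒪^⊳(𝒞_v) ⥲ 𝒪^⊳_{K_v}` of topological monoids.  Thus, one may also think of `𝒞_v` as a
"Frobenioid-theoretic representation" of the topological monoid `𝒪^⊳_{K_v}` [cf. [AbsTopIII], Remark 4.1.1].
Observe that there is a natural topological isomorphism `K_v ⥲ 𝒜_{𝒟_v}`, which may be restricted to `𝒪^⊳_{K_v}` to
obtain an inclusion of topological monoids `κ_v : 𝒪^⊳(𝒞_v) ↪ 𝒜_{𝒟_v}` … `ℱ_v := (𝒞_v, 𝒟_v, κ_v)`» ([IUTchI] Ex 3.4 (i)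
p.80); Def 3.6 (b) p. 87 («`†ℱ_v` is a collection of data `(†𝒞_v, †𝒟_v, †κ_v)` … such that there exists an
isomorphism of collections of data `†ℱ_v ⥲ ℱ_v`»); Rmk 3.5.2 p. 87 (isomorphisms of collections of data satisfy
the «evident compatibility conditions, relative to the various relationships stipulated between the various
constituent data»; the category portion is «an isomorphism class of equivalences of categories»); Def 5.2
(viii) p. 140 («the Kummer structure portion of `‡ℱ_v` may be regarded as an isomorphism of topological monoids
`M_v(‡𝒟_v) ⥲ ‡M_v`», `‡M_v = 𝒪^⊳(‡𝒞_v)`, `M_v(‡𝒟_v) ⊆ 𝒜_{‡𝒟_v}` the «nonzero elements of norm `≤ 1`», Def 5.2 (vii)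
p. 139) ([IUTchI] Def 5.2 (viii) p.140) [claim: Mochizuki2012, status: disputed].  S. Mochizuki, *Topics in
absolute anabelian geometry III*, Def 4.1 (i)–(iii) pp. 101–103, Prop 4.2 (i) p. 105, Rmk 4.1.1 p. 105 («The
topological monoid "`𝒪^⊳_k`" associated to a CAF `k` is essentially the data used to construct the archimedean
Frobenioids of [FrdII], Example 3.3, (ii)») [cite: MochizukiAbsTopIII2015, Definition 4.1 (i) p.101].

WHAT THIS FILE DOES (abc-iut cell; the archimedean ADAPTER between abc-iut-L5-t2's typed Ex 3.4 datum
`ArchLocalFrobenioid K_v` (`LocalFrobenioidsArch.lean`: `𝒟_v` is the shape-only stub `S3Local.AutHolOrbispace`,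
`𝒜_{𝒟_v}` a free CAF) and abc-iut-L4-t10 / abc-iut-w5-d226's MODEL of [AbsTopIII] §4 over the Cor 2.7 (e) interface
`𝔄 : AutHolFieldFunctor` (`HolTFPair 𝔄 = 𝒞^hol_TF`, `HolMonoidPair 𝔄 .TM = 𝒞^hol_TM`); definitions + proofs, no
instance / notation / named `Prop` fact): `HolPresentation 𝔄 X` — `𝒟_v` as an object `D` of `EA` and `𝒜_{𝒟_v}`
identified bicontinuously with Cor 2.7 (e)'s `𝒜_D` (non-vacuous, `nonempty_holPresentation`); Def 4.1 (ii): the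
`TF`-pair `(𝒟_v ↶ K_v)` (`tfPair`) and the `TM`-pair `(𝒟_v ↶ 𝒪^⊳_{K_v})` (`tmPair`), whose Kummer structure read through
`𝒪^⊳(𝒞_v) ⥲ 𝒪^⊳_{K_v}` (`isoM`) IS `κ_v` (`κM_isoM`, Def 4.1 (i) (c) = Ex 3.4 (i), PROVED); Def 5.2 (viii) PROVED at the
datum: `κ_v` is an isomorphism of topological monoids `𝒪^⊳(𝒞_v) ⥲ M_v(𝒟_v)` (`kummerMonoidIso`, from abc-iut-w5-d226's
`ArchPairType.map_mem_arithSubmonoid_iff`, packaged as `arithSubmonoidCongr`); Rmk 3.5.2 at `v ∈ 𝕍^arc`, STIPULATED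
portion: `HolIso` = an isomorphism `φ_𝒟` of `EA` with an isomorphism of topological monoids `𝒪^⊳(¹𝒞_v) ⥲ 𝒪^⊳(²𝒞_v)`
compatible with the Kummer structures through the INDUCED `𝒜_{φ_𝒟}` — determined by `φ_𝒟` (`ext_of_base`), every `φ_𝒟`
lifts (`ofBase`), `HolIso ≃ Isom_EA` (`baseEquiv`); the link to L4 ON ISOMORPHISMS `HolIso ≃ Isom_{𝒞^hol_TM}`
(`toPairIso`, `pairIsoEquiv`, monoid component = the given `𝒪^⊳`-isomorphism, `toPairIso_hom_arith_isoM`), so that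
`HolIso → Isom_EA` bijective is [AbsTopIII] Prop 4.2 (i) (`HolMonoidPair.mapIso_toEA_bijective`) BY NAME
(`base_bijective`).

HONEST LIMITS.  (1) The CATEGORY component `‡𝒞_v` (fields `Cv`, `CTheta`, `dashThetaEquiv`) carries NO stipulated
relationship to `𝒪^⊳(‡𝒞_v)` (field `OC`) in the L5 interface («TODO-merge abc-iut-L1-t4» there), so by Rmk 3.5.2
(i) it does not enter `HolIso`; what makes it enter in print — Rmk 4.1.1 / Ex 3.4 (i) «Frobenioid-theoretic
representation», i.e. `𝒪^⊳(−)` of [FrdI] Thm 3.4 (iii) on isomorphism classes of equivalences of archimedean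
Frobenioids, faithful and full — is layer L1's ([FrdII] Ex 3.3) and is exactly hypothesis (R) of the companion
`FPrimeStripsModelBijectiveOfHolPairRigidity.lean` (row «C53ii/A1», p491595); neither proved nor minted as a fact
here.  (2) MODEL level over a named interface (the Cor 2.7 algorithms are not constructed).  Nothing here bears on
[IUTchIII] Cor. 3.12 or takes a side; nothing asserts abc proved or refuted; typed ≠ proved except where proved.
-/

noncomputable section

namespace Literature.IUT.HodgeTheaters

open CategoryTheory
open Literature.AnabelianGeometry.AbsoluteAnabelian

universe u

/-! ### `𝒪^⊳` is intrinsic: bicontinuous field isomorphisms restrict to isomorphisms of the unit-disc monoids -/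

section UnitDisc

variable {K L : Type u} [NormedField K] [NormedField L]

/-- The L5 monoid `𝒪^⊳_K` of `LocalFrobenioidsArch.lean` and the L4 arithmetic data `M_TM(K)` of [AbsTopIII] Def 4.1
(i) (`ArchPairType.TM.arithSubmonoid`) are the SAME submonoid `{z ≠ 0, ‖z‖ ≤ 1}` of `K` (bridge; no notion
re-declared). [cite: MochizukiAbsTopIII2015, Definition 4.1 (i) p.101] -/
theorem unitDiscMonoid_eq_arithSubmonoid_TM (K : Type u) [NormedField K] :
    unitDiscMonoid K = ArchPairType.TM.arithSubmonoid K :=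
  SetLike.ext fun _ => Iff.rfl

/-- **`M_T(−)` on a bicontinuous field isomorphism** `σ : K ⥲ L`: the induced isomorphism of monoids
`M_T(K) ⥲ M_T(L)` («the formation of `𝒪^⊳_k` … from `k` … is clearly intrinsically defined», Def 4.1 (iii);
membership transported by abc-iut-w5-d226's `ArchPairType.map_mem_arithSubmonoid_iff`).
[cite: MochizukiAbsTopIII2015, Definition 4.1 (iii) p.103] -/
def arithSubmonoidCongr (T : ArchPairType) (σ : K ≃+* L) (hσ : Continuous σ) (hσ' : Continuous σ.symm) :
    T.arithSubmonoid K ≃* T.arithSubmonoid L where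
  toFun x := ⟨σ x, (ArchPairType.map_mem_arithSubmonoid_iff T σ hσ hσ' (x : K)).2 x.2⟩
  invFun y := ⟨σ.symm y, (ArchPairType.map_mem_arithSubmonoid_iff T σ hσ hσ' (σ.symm (y : L))).1
    (by rw [RingEquiv.apply_symm_apply]; exact y.2)⟩
  left_inv x := Subtype.ext (σ.symm_apply_apply (x : K))
  right_inv y := Subtype.ext (σ.apply_symm_apply (y : L))
  map_mul' x y := Subtype.ext (by simp)

/-- `M_T(σ)` is `σ` on elements. [cite: MochizukiAbsTopIII2015, Definition 4.1 (iii) p.103] -/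
@[simp] theorem arithSubmonoidCongr_apply_coe (T : ArchPairType) (σ : K ≃+* L) (hσ : Continuous σ)
    (hσ' : Continuous σ.symm) (x : T.arithSubmonoid K) :
    ((arithSubmonoidCongr T σ hσ hσ' x : T.arithSubmonoid L) : L) = σ x := rfl

/-- `M_T(σ)⁻¹` is `σ⁻¹` on elements. [cite: MochizukiAbsTopIII2015, Definition 4.1 (iii) p.103] -/
@[simp] theorem arithSubmonoidCongr_symm_apply_coe (T : ArchPairType) (σ : K ≃+* L) (hσ : Continuous σ)
    (hσ' : Continuous σ.symm) (y : T.arithSubmonoid L) :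
    (((arithSubmonoidCongr T σ hσ hσ').symm y : T.arithSubmonoid K) : K) = σ.symm y := rfl

/-- `M_T(σ)` is continuous (subspace topologies). [cite: MochizukiAbsTopIII2015, Definition 4.1 (iii) p.103] -/
theorem continuous_arithSubmonoidCongr (T : ArchPairType) (σ : K ≃+* L) (hσ : Continuous σ)
    (hσ' : Continuous σ.symm) : Continuous (arithSubmonoidCongr T σ hσ hσ') :=
  (hσ.comp continuous_subtype_val).subtype_mk _

/-- … with continuous inverse: an isomorphism of topological monoids. [cite: MochizukiAbsTopIII2015, Definition 4.1 (iii) p.103] -/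
theorem continuous_arithSubmonoidCongr_symm (T : ArchPairType) (σ : K ≃+* L) (hσ : Continuous σ)
    (hσ' : Continuous σ.symm) : Continuous (arithSubmonoidCongr T σ hσ hσ').symm :=
  (hσ'.comp continuous_subtype_val).subtype_mk _

end UnitDisc

namespace ArchLocalFrobenioid

variable {Kv : Type u} [NormedField Kv] [NormedAlgebra ℝ Kv]

/-- The completion `K_v` of an Ex 3.4 datum is a CAF in the sense of [AbsTopIII] §0 (tree `IsCAF`): it is
bicontinuously field-isomorphic to `𝒜_{𝒟_v}` (`fieldIso`), itself a CAF (`caf`). [cite: Mochizuki2012, Ex 3.4 (i) p.80] -/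
theorem isCAF_completion (X : ArchLocalFrobenioid.{u} Kv) : IsCAF Kv := by
  obtain ⟨e, he, he'⟩ := X.caf
  exact ⟨⟨X.fieldIso.trans e, he.comp X.fieldIso_continuous, X.fieldIso_continuous_symm.comp he'⟩⟩

/-- `κ_v` unfolded: `κ_v(m)` is the image under `K_v ⥲ 𝒜_{𝒟_v}` of `(𝒪^⊳(𝒞_v) ⥲ 𝒪^⊳_{K_v})(m) ∈ K_v` (definition of
`kappa`). [cite: Mochizuki2012, Ex 3.4 (i) p.80] -/
theorem kappa_apply (X : ArchLocalFrobenioid.{u} Kv) (m : X.OC) :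
    X.kappa m = X.fieldIso ((X.isoOK m : unitDiscMonoid Kv) : Kv) := rfl

/-! ### The datum read through the [AbsTopIII] Cor 2.7 (e) interface -/

/-- **An Ex 3.4 (i) datum PRESENTED OVER the [AbsTopIII] §4 interface `𝔄`**: the Aut-holomorphic orbispace `𝒟_v`
as an object `D` of `EA` (an elliptically admissible Aut-holomorphic orbispace — `𝒟_v = 𝕏̲→_v` is one, Ex 3.4 (i) /
Def 3.1 (f) / [AbsTopIII] Def 4.1) and the CAF `𝒜_{𝒟_v}` of the datum identified, bicontinuously, with the field
`𝒜_D` «algorithmically constructed from `𝒟_v`» of Cor 2.7 (e) carried by `𝔄`.  (The L5 interface records `𝒟_v`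
only as the shape-only stub `S3Local.AutHolOrbispace` and `𝒜_{𝒟_v}` as a free CAF; this structure is the reading of
both through abc-iut-L4-t10's `AutHolFieldFunctor`.) [cite: Mochizuki2012, Ex 3.4 (i) p.80] -/
structure HolPresentation (𝔄 : AutHolFieldFunctor.{u}) (X : ArchLocalFrobenioid.{u} Kv) : Type (u + 1) where
  /-- `𝒟_v` as an object of `EA` -/
  D : 𝔄.EA
  /-- the identification `𝒜_{𝒟_v} ⥲ 𝒜_D` with Cor 2.7 (e)'s field … -/
  afieldIso : X.Afield ≃+* 𝔄.A D
  /-- … continuous … -/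
  continuous_afieldIso : Continuous afieldIso
  /-- … with continuous inverse -/
  continuous_afieldIso_symm : Continuous afieldIso.symm

/-- Presentations exist over every object of `EA`: `𝒜_{𝒟_v}` and `𝒜_D` are both CAFs, hence bicontinuously
isomorphic (through `ℂ`).  [Which identification is the natural one is the content of Cor 2.7 (e), interface
data; this is non-vacuity only.] [cite: MochizukiAbsTopIII2015, Definition 4.1 (i) p.101] -/
theorem nonempty_holPresentation (𝔄 : AutHolFieldFunctor.{u}) (X : ArchLocalFrobenioid.{u} Kv) (D : 𝔄.EA) :
    Nonempty (HolPresentation 𝔄 X) := by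
  obtain ⟨e, he, he'⟩ := X.caf
  obtain ⟨f, hf, hf'⟩ := (𝔄.isCAF D).exists_equiv
  exact ⟨⟨D, e.trans f.symm, hf'.comp he, he'.comp hf⟩⟩

namespace HolPresentation

variable {𝔄 : AutHolFieldFunctor.{u}} {X : ArchLocalFrobenioid.{u} Kv} (π : HolPresentation 𝔄 X)

/-- The «natural topological isomorphism `K_v ⥲ 𝒜_{𝒟_v}`» of Ex 3.4 (i), read in `𝒜_D`: `K_v ⥲ 𝒜_{𝒟_v} ⥲ 𝒜_D` — a
`K_v`-Kummer structure on `D` in the sense of [AbsTopIII] Def 4.1 (i) («any isomorphism of topological fields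
`κ_k : k ⥲ 𝒜_𝕏`»). [cite: Mochizuki2012, Ex 3.4 (i) p.80] -/
def kummerField : Kv ≃+* 𝔄.A π.D := X.fieldIso.trans π.afieldIso

/-- `K_v ⥲ 𝒜_D` on elements. [cite: Mochizuki2012, Ex 3.4 (i) p.80] -/
@[simp] theorem kummerField_apply (x : Kv) : π.kummerField x = π.afieldIso (X.fieldIso x) := rfl

/-- `K_v ⥲ 𝒜_D` is continuous. [cite: Mochizuki2012, Ex 3.4 (i) p.80] -/
theorem continuous_kummerField : Continuous π.kummerField :=
  π.continuous_afieldIso.comp X.fieldIso_continuous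

/-- … with continuous inverse. [cite: Mochizuki2012, Ex 3.4 (i) p.80] -/
theorem continuous_kummerField_symm : Continuous π.kummerField.symm :=
  X.fieldIso_continuous_symm.comp π.continuous_afieldIso_symm

/-- **[AbsTopIII] Def 4.1 (ii) at the Ex 3.4 (i) datum, `T = TF`**: the Aut-holomorphic `TF`-pair
`(𝒟_v ↶ K_v)` — structure-orbispace `D`, arithmetic data the CAF `K_v`, Kummer structure `K_v ⥲ 𝒜_D` — an object of
abc-iut-L4-t10's `𝒞^hol_TF = HolTFPair 𝔄`. [cite: MochizukiAbsTopIII2015, Definition 4.1 (ii) p.102] -/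
def tfPair : HolTFPair 𝔄 where
  X := π.D
  k := Kv
  isCAF := X.isCAF_completion
  κ := π.kummerField
  continuous_κ := π.continuous_kummerField
  continuous_κ_symm := π.continuous_kummerField_symm

/-- The structure-orbispace of `(𝒟_v ↶ K_v)` is `D`. [cite: MochizukiAbsTopIII2015, Definition 4.1 (ii) p.102] -/
@[simp] theorem tfPair_X : π.tfPair.X = π.D := rfl

/-- The Kummer structure of `(𝒟_v ↶ K_v)` is `K_v ⥲ 𝒜_{𝒟_v} ⥲ 𝒜_D`. [cite: MochizukiAbsTopIII2015, Definition 4.1 (ii) p.102] -/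
@[simp] theorem tfPair_κ_apply (x : Kv) : π.tfPair.κ x = π.afieldIso (X.fieldIso x) := rfl

/-- **[AbsTopIII] Def 4.1 (ii) at the Ex 3.4 (i) datum, `T = TM`**: the Aut-holomorphic `TM`-pair
`(𝒟_v ↶ 𝒪^⊳_{K_v})` with Kummer structure «the restriction of `κ_k` to `M_k ⊆ k`» (Def 4.1 (i) (c)) — an object of
abc-iut-w5-d226's `𝒞^hol_TM = HolMonoidPair 𝔄 .TM`; by Rmk 4.1.1 this is «essentially the data used to construct
the archimedean Frobenioid» `𝒞_v`. [cite: MochizukiAbsTopIII2015, Definition 4.1 (ii) p.102] -/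
def tmPair : HolMonoidPair 𝔄 .TM where
  toHolTFPair := π.tfPair
  isMonoidType := ArchPairType.isMonoidType_TM

/-- The structure-orbispace of `(𝒟_v ↶ 𝒪^⊳_{K_v})` is `D`. [cite: MochizukiAbsTopIII2015, Definition 4.1 (ii) p.102] -/
@[simp] theorem tmPair_X : π.tmPair.X = π.D := rfl

/-- **Ex 3.4 (i) «natural isomorphism `𝒪^⊳(𝒞_v) ⥲ 𝒪^⊳_{K_v}`», read as an isomorphism onto the arithmetic data
`M_TM(K_v)` of the `TM`-pair** (the L5 and L4 unit-disc monoids coincide, `unitDiscMonoid_eq_arithSubmonoid_TM`).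
[cite: Mochizuki2012, Ex 3.4 (i) p.80] -/
def isoM : X.OC ≃* π.tmPair.M :=
  X.isoOK.trans (MulEquiv.submonoidCongr (unitDiscMonoid_eq_arithSubmonoid_TM Kv))

/-- `isoM` is `𝒪^⊳(𝒞_v) ⥲ 𝒪^⊳_{K_v}` on elements. [cite: Mochizuki2012, Ex 3.4 (i) p.80] -/
@[simp] theorem isoM_apply_coe (m : X.OC) :
    ((π.isoM m : π.tmPair.M) : π.tmPair.k) = ((X.isoOK m : unitDiscMonoid Kv) : Kv) := rfl

/-- `isoM` is continuous. [cite: Mochizuki2012, Ex 3.4 (i) p.80] -/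
theorem continuous_isoM : Continuous π.isoM := by
  have h : Continuous fun m : X.OC => (X.isoOK m : Kv) := continuous_subtype_val.comp X.isoOK_continuous
  exact h.subtype_mk _

/-- … with continuous inverse. [cite: Mochizuki2012, Ex 3.4 (i) p.80] -/
theorem continuous_isoM_symm : Continuous π.isoM.symm := by
  have h : Continuous fun y : π.tmPair.M =>
      (⟨(y : π.tmPair.k), by rw [unitDiscMonoid_eq_arithSubmonoid_TM]; exact y.2⟩ : unitDiscMonoid Kv) :=
    continuous_subtype_val.subtype_mk _
  exact X.isoOK_continuous_symm.comp h

/-- **[AbsTopIII] Def 4.1 (i) (c) = [IUTchI] Ex 3.4 (i)**: read through `𝒪^⊳(𝒞_v) ⥲ 𝒪^⊳_{K_v}`, the Kummer structure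
`κ_{M_k}` of the `TM`-pair `(𝒟_v ↶ 𝒪^⊳_{K_v})` («the restriction of `κ_k` to `M_k ⊆ k`») IS the Kummer structure `κ_v`
of the Ex 3.4 datum («`K_v ⥲ 𝒜_{𝒟_v}` … restricted to `𝒪^⊳_{K_v}` … `κ_v : 𝒪^⊳(𝒞_v) ↪ 𝒜_{𝒟_v}`»), read in `𝒜_D` — PROVED.
[cite: Mochizuki2012, Ex 3.4 (i) p.80] -/
theorem κM_isoM (m : X.OC) : π.tmPair.κM (π.isoM m) = π.afieldIso (X.kappa m) := rfl

/-- `M_v(𝒟_v) := 𝒪^⊳_{𝒜_{𝒟_v}}`, «the topological submonoid consisting of nonzero elements of norm `≤ 1` [i.e.,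
"`𝒪^⊳_ℂ`"]» of Def 5.2 (vii), read in `𝒜_D`: the arithmetic data `M_TM(𝒜_D)` (abbreviation; no notion re-declared).
([IUTchI] Def 5.2 (vii) p.139) [claim: Mochizuki2012, status: disputed] -/
abbrev Mv : Submonoid (𝔄.A π.D) := ArchPairType.TM.arithSubmonoid (𝔄.A π.D)

/-- **[IUTchI] Def 5.2 (viii) PROVED at the datum**: «the Kummer structure portion of `‡ℱ_v` may be regarded as
an isomorphism of topological monoids `M_v(‡𝒟_v) ⥲ ‡M_v`» — here the inverse direction, `κ_v` as an isomorphism of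
monoids `𝒪^⊳(𝒞_v) ⥲ M_v(𝒟_v) = 𝒪^⊳_{𝒜_D}`: `𝒪^⊳(𝒞_v) ⥲ 𝒪^⊳_{K_v}` followed by `M_TM` of the field isomorphism
`K_v ⥲ 𝒜_D`. ([IUTchI] Def 5.2 (viii) p.140) [claim: Mochizuki2012, status: disputed] -/
def kummerMonoidIso : X.OC ≃* π.Mv :=
  π.isoM.trans (arithSubmonoidCongr .TM π.kummerField π.continuous_kummerField π.continuous_kummerField_symm)

/-- On elements `kummerMonoidIso` IS `κ_v` (read in `𝒜_D`). ([IUTchI] Def 5.2 (viii) p.140) [claim: Mochizuki2012, status: disputed] -/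
@[simp] theorem kummerMonoidIso_apply_coe (m : X.OC) :
    ((π.kummerMonoidIso m : π.Mv) : 𝔄.A π.D) = π.afieldIso (X.kappa m) := rfl

/-- `κ_v : 𝒪^⊳(𝒞_v) ⥲ M_v(𝒟_v)` is continuous … ([IUTchI] Def 5.2 (viii) p.140) [claim: Mochizuki2012, status: disputed] -/
theorem continuous_kummerMonoidIso : Continuous π.kummerMonoidIso :=
  (continuous_arithSubmonoidCongr .TM π.kummerField π.continuous_kummerField
    π.continuous_kummerField_symm).comp π.continuous_isoM

/-- … with continuous inverse: «an isomorphism of topological monoids». ([IUTchI] Def 5.2 (viii) p.140)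
[claim: Mochizuki2012, status: disputed] -/
theorem continuous_kummerMonoidIso_symm : Continuous π.kummerMonoidIso.symm :=
  π.continuous_isoM_symm.comp (continuous_arithSubmonoidCongr_symm .TM π.kummerField
    π.continuous_kummerField π.continuous_kummerField_symm)

end HolPresentation

/-! ### Isomorphisms of presented data (Rmk 3.5.2 at `v ∈ 𝕍^arc`, the stipulated portion) and the link to `𝒞^hol_TM` -/

variable {Kv₁ : Type u} [NormedField Kv₁] [NormedAlgebra ℝ Kv₁]
variable {Kv₂ : Type u} [NormedField Kv₂] [NormedAlgebra ℝ Kv₂]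
variable {𝔄 : AutHolFieldFunctor.{u}} {X₁ : ArchLocalFrobenioid.{u} Kv₁} {X₂ : ArchLocalFrobenioid.{u} Kv₂}

/-- **An isomorphism of presented Ex 3.4 / Def 3.6 (b) data** `(¹𝒞_v, ¹𝒟_v, ¹κ_v) ⥲ (²𝒞_v, ²𝒟_v, ²κ_v)`, STIPULATED
portion (Rmk 3.5.2 (i): «evident compatibility conditions, relative to the various relationships stipulated
between the various constituent data»): an isomorphism `φ_𝒟 : ¹𝒟_v ⥲ ²𝒟_v` of Aut-holomorphic orbispaces (of `EA`),
an isomorphism of topological monoids `φ_𝕄 : 𝒪^⊳(¹𝒞_v) ⥲ 𝒪^⊳(²𝒞_v)` (the effect on `𝒪^⊳(−)` of the category portion),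
compatible with the Kummer structures through the isomorphism `𝒜_{φ_𝒟}` INDUCED by `φ_𝒟` (Cor 2.7 functoriality):
`²κ_v ∘ φ_𝕄 = 𝒜_{φ_𝒟} ∘ ¹κ_v`.  The category portion `¹𝒞_v ⥲ ²𝒞_v` itself is not constrained by the L5 interface (see
the module docstring, HONEST LIMITS (1)). ([IUTchI] Rmk 3.5.2 p.87) [claim: Mochizuki2012, status: disputed] -/
@[ext]
structure HolIso (π₁ : HolPresentation 𝔄 X₁) (π₂ : HolPresentation 𝔄 X₂) : Type (u + 1) where
  /-- `φ_𝒟`, an isomorphism of `EA` -/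
  base : π₁.D ≅ π₂.D
  /-- `φ_𝕄 : 𝒪^⊳(¹𝒞_v) ⥲ 𝒪^⊳(²𝒞_v)`, an isomorphism of monoids … -/
  monoid : X₁.OC ≃* X₂.OC
  /-- … continuous … -/
  continuous_monoid : Continuous monoid
  /-- … with continuous inverse -/
  continuous_monoid_symm : Continuous monoid.symm
  /-- compatibility with the Kummer structures through the induced `𝒜_{φ_𝒟}` -/
  compat : ∀ m : X₁.OC, π₂.afieldIso (X₂.kappa (monoid m)) = 𝔄.Amap base.hom (π₁.afieldIso (X₁.kappa m))

namespace HolIso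

variable {π₁ : HolPresentation 𝔄 X₁} {π₂ : HolPresentation 𝔄 X₂}

/-- **An isomorphism of presented data is DETERMINED by its `𝒟`-portion**: the Kummer structures are injective,
so `φ_𝕄 = (²κ_v)⁻¹ ∘ 𝒜_{φ_𝒟} ∘ ¹κ_v` (the injectivity portion of [AbsTopIII] Prop 4.2 (i) at this datum, «from the
required compatibility of morphisms … with the Kummer structures»). ([IUTchI] Cor 5.3 (ii) p.144) [claim: Mochizuki2012, status: disputed] -/
theorem ext_of_base {φ ψ : HolIso π₁ π₂} (h : φ.base = ψ.base) : φ = ψ := by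
  refine HolIso.ext h (MulEquiv.ext fun m => ?_)
  have h1 : π₂.afieldIso (X₂.kappa (φ.monoid m)) = π₂.afieldIso (X₂.kappa (ψ.monoid m)) := by
    rw [φ.compat, ψ.compat, h]
  exact X₂.kappa_injective (π₂.afieldIso.injective h1)

variable (π₁ π₂) in
/-- **Every isomorphism `φ_𝒟 : ¹𝒟_v ⥲ ²𝒟_v` of `EA` LIFTS to an isomorphism of presented data**, with monoid portion
`(²κ_v)⁻¹ ∘ M_TM(𝒜_{φ_𝒟}) ∘ ¹κ_v` — well defined BECAUSE each `κ_v` is an isomorphism onto `M_v(𝒟_v)` (Def 5.2 (viii),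
`kummerMonoidIso`) and `𝒜_{φ_𝒟}` carries `M_v(¹𝒟_v)` onto `M_v(²𝒟_v)` (the surjectivity portion of [AbsTopIII] Prop 4.2 (i)
at this datum). ([IUTchI] Cor 5.3 (ii) p.144) [claim: Mochizuki2012, status: disputed] -/
def ofBase (f : π₁.D ≅ π₂.D) : HolIso π₁ π₂ where
  base := f
  monoid := (π₁.kummerMonoidIso.trans
    (arithSubmonoidCongr .TM (𝔄.Amap f.hom) (𝔄.continuous_Amap f.hom) (𝔄.continuous_Amap_symm f.hom))).trans
      π₂.kummerMonoidIso.symm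
  continuous_monoid := π₂.continuous_kummerMonoidIso_symm.comp
    ((continuous_arithSubmonoidCongr .TM (𝔄.Amap f.hom) (𝔄.continuous_Amap f.hom)
      (𝔄.continuous_Amap_symm f.hom)).comp π₁.continuous_kummerMonoidIso)
  continuous_monoid_symm := by
    change Continuous fun n => π₁.kummerMonoidIso.symm
      ((arithSubmonoidCongr .TM (𝔄.Amap f.hom) (𝔄.continuous_Amap f.hom)
        (𝔄.continuous_Amap_symm f.hom)).symm (π₂.kummerMonoidIso n))
    exact π₁.continuous_kummerMonoidIso_symm.comp
      ((continuous_arithSubmonoidCongr_symm .TM (𝔄.Amap f.hom) (𝔄.continuous_Amap f.hom)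
        (𝔄.continuous_Amap_symm f.hom)).comp π₂.continuous_kummerMonoidIso)
  compat m := by
    have key : ∀ n : π₂.Mv, π₂.afieldIso (X₂.kappa (π₂.kummerMonoidIso.symm n)) = (n : 𝔄.A π₂.D) := fun n => by
      rw [← HolPresentation.kummerMonoidIso_apply_coe, MulEquiv.apply_symm_apply]
    show π₂.afieldIso (X₂.kappa (π₂.kummerMonoidIso.symm
      (arithSubmonoidCongr .TM (𝔄.Amap f.hom) (𝔄.continuous_Amap f.hom) (𝔄.continuous_Amap_symm f.hom)
        (π₁.kummerMonoidIso m)))) = _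
    rw [key, arithSubmonoidCongr_apply_coe, HolPresentation.kummerMonoidIso_apply_coe]

/-- The lift of `φ_𝒟` lies over `φ_𝒟`. ([IUTchI] Cor 5.3 (ii) p.144) [claim: Mochizuki2012, status: disputed] -/
@[simp] theorem ofBase_base (f : π₁.D ≅ π₂.D) : (ofBase π₁ π₂ f).base = f := rfl

variable (π₁ π₂) in
/-- **Isomorphisms of presented data ≃ `Isom_EA(¹𝒟_v, ²𝒟_v)`**, `φ ↦ φ_𝒟` (the two portions of Prop 4.2 (i) at the
datum). ([IUTchI] Cor 5.3 (ii) p.144) [claim: Mochizuki2012, status: disputed] -/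
def baseEquiv : HolIso π₁ π₂ ≃ (π₁.D ≅ π₂.D) where
  toFun φ := φ.base
  invFun f := ofBase π₁ π₂ f
  left_inv _ := ext_of_base rfl
  right_inv _ := rfl

/-- **The link to `𝒞^hol_TM` on isomorphisms**: an isomorphism of presented data yields the isomorphism of the
underlying Aut-holomorphic `TM`-pairs `(¹𝒟_v ↶ 𝒪^⊳_{K_{v,1}}) ⥲ (²𝒟_v ↶ 𝒪^⊳_{K_{v,2}})` over `φ_𝒟` (the unique one,
Prop 4.2 (i); abc-iut-w5-d226's `HolMonoidPair.Hom.ofBase`). ([IUTchI] Cor 5.3 (ii) p.144) [claim: Mochizuki2012, status: disputed] -/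
def toPairIso (φ : HolIso π₁ π₂) : π₁.tmPair ≅ π₂.tmPair where
  hom := HolMonoidPair.Hom.ofBase _ _ φ.base.hom
  inv := HolMonoidPair.Hom.ofBase _ _ φ.base.inv
  hom_inv_id := HolMonoidPair.Hom.ext_of_base (by
    rw [HolMonoidPair.comp_base, HolMonoidPair.Hom.ofBase_base, HolMonoidPair.Hom.ofBase_base,
      Iso.hom_inv_id, HolMonoidPair.id_base])
  inv_hom_id := HolMonoidPair.Hom.ext_of_base (by
    rw [HolMonoidPair.comp_base, HolMonoidPair.Hom.ofBase_base, HolMonoidPair.Hom.ofBase_base,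
      Iso.inv_hom_id, HolMonoidPair.id_base])

/-- `toPairIso φ` lies over `φ_𝒟`: `((𝕏 ↶ M) ↦ 𝕏)(toPairIso φ) = φ_𝒟`. ([IUTchI] Cor 5.3 (ii) p.144) [claim: Mochizuki2012, status: disputed] -/
@[simp] theorem toEA_mapIso_toPairIso (φ : HolIso π₁ π₂) :
    (HolMonoidPair.toEA 𝔄 .TM).mapIso (toPairIso φ) = φ.base := Iso.ext rfl

/-- **The `TM`-pair isomorphism's monoid component IS `φ_𝕄`**, read through `𝒪^⊳(ⁱ𝒞_v) ⥲ 𝒪^⊳_{K_{v,i}}`: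
`(toPairIso φ)_M ∘ isoM₁ = isoM₂ ∘ φ_𝕄` — the arithmetic part `κ₂⁻¹ ∘ 𝒜_{φ_𝒟} ∘ κ₁` forced by Prop 4.2 (i) agrees with
the given `𝒪^⊳`-isomorphism, by the Kummer compatibility. ([IUTchI] Cor 5.3 (ii) p.144) [claim: Mochizuki2012, status: disputed] -/
theorem toPairIso_hom_arith_isoM (φ : HolIso π₁ π₂) (m : X₁.OC) :
    (toPairIso φ).hom.arith (π₁.isoM m) = π₂.isoM (φ.monoid m) := by
  apply Subtype.ext
  apply π₂.kummerField.injective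
  change π₂.tmPair.κ (((toPairIso φ).hom.arith (π₁.isoM m) : π₂.tmPair.M) : π₂.tmPair.k) =
    π₂.kummerField ((π₂.isoM (φ.monoid m) : π₂.tmPair.M) : π₂.tmPair.k)
  rw [HolMonoidPair.Hom.arith_coe, RingEquiv.apply_symm_apply]
  change 𝔄.Amap φ.base.hom (π₁.tmPair.κM (π₁.isoM m)) = π₂.tmPair.κM (π₂.isoM (φ.monoid m))
  rw [HolPresentation.κM_isoM, HolPresentation.κM_isoM, φ.compat]

variable (π₁ π₂) in
/-- **Isomorphisms of presented data ≃ `Isom_{𝒞^hol_TM}(tmPair₁, tmPair₂)`** (`φ ↦ toPairIso φ`, inverse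
`ψ ↦` the lift of `ψ_𝕏`): the (𝒟, 𝒪^⊳, κ)-portion of an isomorphism of collections of data IS an isomorphism of the
underlying Aut-holomorphic `TM`-pairs (Rmk 4.1.1).  The inverse law uses the injectivity portion of [AbsTopIII]
Prop 4.2 (i) (`HolMonoidPair.mapIso_toEA_bijective`, BY NAME). ([IUTchI] Cor 5.3 (ii) p.144) [claim: Mochizuki2012, status: disputed] -/
def pairIsoEquiv : HolIso π₁ π₂ ≃ (π₁.tmPair ≅ π₂.tmPair) where
  toFun := toPairIso
  invFun ψ := ofBase π₁ π₂ ((HolMonoidPair.toEA 𝔄 .TM).mapIso ψ)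
  left_inv φ := ext_of_base (by rw [ofBase_base, toEA_mapIso_toPairIso])
  right_inv ψ := (HolMonoidPair.mapIso_toEA_bijective π₁.tmPair π₂.tmPair).1 (by
    change (HolMonoidPair.toEA 𝔄 .TM).mapIso (toPairIso (ofBase π₁ π₂ _)) = _
    rw [toEA_mapIso_toPairIso, ofBase_base])

variable (π₁ π₂) in
/-- **[IUTchI] Cor 5.3 (ii) at `v ∈ 𝕍^arc`, the stipulated portion, from [AbsTopIII] Prop 4.2 (i) BY NAME**: the map
«isomorphisms of presented data `(¹𝒞_v, ¹𝒟_v, ¹κ_v) ⥲ (²𝒞_v, ²𝒟_v, ²κ_v)`» `→ Isom_EA(¹𝒟_v, ²𝒟_v)`, `φ ↦ φ_𝒟`, is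
bijective — it is `pairIsoEquiv` followed by the bijection `Isom_{𝒞^hol_TM} ⥲ Isom_EA` of Prop 4.2 (i)
(`HolMonoidPair.mapIso_toEA_bijective`).  [The category portion `¹𝒞_v ⥲ ²𝒞_v` is the residual (R) of
`FPrimeStripsModelBijectiveOfHolPairRigidity.lean`.] ([IUTchI] Cor 5.3 (ii) p.144) [claim: Mochizuki2012, status: disputed] -/
theorem base_bijective : Function.Bijective fun φ : HolIso π₁ π₂ => φ.base := by
  have h : (fun φ : HolIso π₁ π₂ => φ.base) =
      (fun ψ : π₁.tmPair ≅ π₂.tmPair => (HolMonoidPair.toEA 𝔄 .TM).mapIso ψ) ∘ pairIsoEquiv π₁ π₂ :=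
    funext fun φ => (toEA_mapIso_toPairIso φ).symm
  rw [h]
  exact (HolMonoidPair.mapIso_toEA_bijective π₁.tmPair π₂.tmPair).comp (pairIsoEquiv π₁ π₂).bijective

end HolIso

end ArchLocalFrobenioid

end Literature.IUT.HodgeTheaters

end
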